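import Literature.Geometry.Kaehler.ComplexTorusSelfIntersectionIndex
import Literature.Geometry.Kaehler.ComplexTorusThetaKunnethFinite
import Literature.Geometry.Kaehler.ComplexTorusLefschetzGroupFiniteProduct
import Literature.Geometry.Kaehler.ComplexTorusAppellHumbertGroup
import Literature.Geometry.Kaehler.ComplexTorusEllipticCurve
import Literature.Geometry.Kaehler.ComplexTorusDualPolarizationType
import HarnessLib

/-!
# Venture HSemireg — (S3)'s positivity input at EVERY dimension: the diagonal classes `η_c = Σ_k c_k e_k` on a product of elliptic
# curves `E_{τ₀} × ⋯ × E_{τ_{g-1}}` (`c ∈ (ℤ∖0)^g`) have index `#{k : c_k < 0}` and `∫_{E_τ^g} η_c^{∧g} = (-1)^g · g! · ∏_k c_k`; so EVERY index `0 ≤ s ≤ g`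
# occurs on an abelian variety of every dimension `g`, with `∫ = (-1)^{g+s} g!` — the sign law «sign ∫_X bⁿ = (-1)^{n+s(b)}»
# is SHARP at every `n` and (H1) fails for an honest `NS` class at every even `n ≥ 2`; TRACK S4-PUSH (ii), seat `s4-prove-1`
# (g9); file of record `s4push/prove-1/ATTEMPT-10.md` §2; file V-b of the lane's object-level series (III, IV, IVb, V-a)

HONEST FRAMING. Lean index of the computation cell `pub-hsemireg`. OBJECT LEVEL in the sense of file III and only that object: the
complex torus of the tree's Literature layer `Literature/Geometry/Kaehler/ComplexTorus*` (lane `lit-hodgefound`) — here the product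
`∏_{k<g} E_{τ_k}` of elliptic curves built with `piPeriod` (`E_τ = ℂ/(ℤτ + ℤ)`, `ellipticPeriod`, `Im τ_k > 0`; written `E_τ^g` below, the
statements allow a different `τ_k` per factor), its `NS` forms `piForm`,
`∫_X := ComplexTorus.torusIntegral` (complex orientation), the intrinsic index `ComplexTorus.hermIndex` of Lange's `H`.  No sheaf,
no secant plane, no Ext group and no semiregularity map is constructed; th-7 §D's χ-identity enters BY VALUE exactly as in files
IV/IVb; nothing here says that HC, HC_CM or HC_AV holds; nothing here is a new case of anything; (S3)'s signed words («PROVED given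
`∫bⁿ > 0`», STRUCTURE.md v1.0 §2; STATUS WORD s4-ref P-2) do not move.  NO definition, NO named fact: theorems only, all PROVED
(0 sorry), standard axioms.  Independent of file V-a (`…IndexAdditivity`): the index is computed directly on the standard basis.

WHAT IS ADDED TO THE LANE'S RECORD (sheet `s4push/prove-1/STATEMENTS-S3INPUT.md`, new row S3INP-10 (b)).  So far the lane had the
criterion «(H1) ⟺ `g + index` even» as a theorem about `∫_X` (file III) and TWO hand-made classes of intermediate index (`n = 2`,
file IV; `n = 4`, file IVb — the sheet's `E⁴`, `∫b⁴ = -24`).  Here, for every `g`, every `τ` in the upper half plane and every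
`c : Fin g → ℤ` (the sheet's «`b = Σ c_k e_k` (fibre classes)» on `X = E^g`):
* §1 `isNSForm_diag` (`η_c ∈ NS(E_τ^g)`), `hermOf_diag` (`H_{η_c} = diag(c_k / Im τ)` on the standard basis of `ℂ^g`),
  **`hermIndex_diag`** (`index = #{k : c_k < 0}`, all `c_k ≠ 0`; Sylvester, tree `hermIndex_eq_card_of_orthogonal`),
  `nondegenerate_diag`, `det_latticeGram_diag` (Gram `= diag(c_k J₂)`, `det = ∏ c_k²`; tree `latticeGram_pi`, `det_piBlockDiag`),
  **`torusIntegral_wedgePow_diag_eq_abs`** (`∫ η_c^{∧g} = (-1)^{g + #{c_k<0}} g! ∏|c_k|`, the tree's Lemma 1.7.5 formula with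
  `d₁⋯d_g = ∏|c_k|`) and the closed form **`torusIntegral_wedgePow_diag_eq`: `∫_{E_τ^g} (Σ c_k e_k)^{∧g} = (-1)^g · g! · ∏_k c_k`**
  (multilinearity; `∫ e₁⋯e_g = (-1)^g` in the complex orientation — each `E_τ = -dx∧dy/Im τ` has `∫_{E_τ} E_τ = -1`, Lange's
  sign `(-1)^{g+s}` at `s = 0`; convention note of the sheet's S3INP-1 PRECISION: at EVEN `g` every convention agrees);
* §2 the sign classes `η_s` (`c_k = -1` for `k < s`, `+1` otherwise): **`hermIndex_signDiag`** (`= s` for `s ≤ g`),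
  **`torusIntegral_wedgePow_signDiag_eq`** (`∫ η_s^{∧g} = (-1)^{g+s} g!`), packaged with `IsAbelianVariety (E_τ^g)` as
  **`exists_isNSForm_hermIndex_eq_torusIntegral_eq`** = S3INP-10: EVERY INDEX IS REALISED AT EVERY DIMENSION, so the sign law is
  sharp; `torusIntegral_wedgePow_signDiag_one_neg` — **(H1) FAILS at every even `n = 2m ≥ 2`** (`η₁ = -e₀ + Σ_{k≥1} e_k`, index `1`,
  `∫ = -(2m)! < 0`); `torusIntegral_wedgePow_signDiag_zero_pos` ((H1) holds for `Σ e_k`, `∫ = (2m)!`);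
* §2 (end) **`chi_identity_signDiag`**: for EVERY `n = 2m` and EVERY `s ≤ 2m` with `m + s` odd, `η_s` satisfies file IV's
  χ-identity by value with `d = w = 1`, `G = 4ᵐ` (`m = 1, s = 0`: IV's `G = 4`; `m = 2, s = 1`: IVb's `G = 16`) — both branches of
  the object-level signed law have inhabited hypothesis sets at every `n ≥ 2` (`chi_identity_signDiag_succ`, `s = m + 1`), and the
  numerical constraint says nothing beyond the parity `m + s` odd.  The kernel instantiation of file IV's theorems on these classes
  (and on IVb's `η₄`, s4-ref g16 P-1) is a separate tiny leaf importing IV/IVb once their hub oleans are current.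

PRESEARCH (2026-08-23, g9): Literature layer: `piPeriod`/`piForm`/`hermOf_piForm`/`IsNSForm.pi`/`latticeGram_pi`/`det_piBlockDiag`
exist (finite products, rows of `ComplexTorusFiniteProduct`, `…ThetaKunnethFinite`, `…LefschetzGroupFiniteProduct`); no class of
prescribed index `s` on `E^g` and no `hermIndex` of a `piForm` (`lean search` → none).  Corpus/galaxy: the facts are textbook
(Lange §1.7 with §2.4.4 Thm. 2.4.25; Mumford AV §16); nothing new is claimed beyond the kernel record.

Statements and proofs: s4-prove-1 g9 (2026-08-23), seat ×1 + kernel; reads invited: s4-ref (statement read / vacuity), s4-prove-3 (×2).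

## References

* [Lange2023AbelianVarietiesComplex] H. Lange, Abelian Varieties over the Complex Numbers (2023), §1.2.2 Lemma 1.2.10, §1.3.1 (1.10),
  §1.5.1, §1.6.2 (index), §1.7.1 Thm. 1.7.1, §1.7.2 Thm. 1.7.3 and Lemma 1.7.5 with its proof, §2.1.1 Example 2.1.3, §2.4.4 Thm. 2.4.25 —
  held text `book:lange1992-complex-abelian-varieties` (2023 numbering), as cited in the imported Literature files.
* [GohbergLancasterRodman2005] Gohberg–Lancaster–Rodman, Indefinite Linear Algebra and Applications (2005), §2.2, §2.3 Thm. 2.3.2 (Sylvester).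
* Cell records: STRUCTURE.md v1.0-SIGNED §2 (S3); theory/FORMULA-N-th7.md §D; STATEMENTS-S3INPUT.md rows S3INP-1, -4, -8, -9, -10;
  ATTEMPT-10.md §2; files III/IV/IVb/V-a.
-/

noncomputable section

open scoped ComplexOrder
open Complex Module
open Literature.Geometry.Kaehler Literature.Geometry.Kaehler.ComplexTorus

namespace Summit.Ventures.HSemireg

namespace SecantParity

/-! ### §0 Folklore helpers (private copies; the public ones live in file V-a) -/

section Helpers

variable {E : Type*} [NormedAddCommGroup E] [NormedSpace ℂ E]
/-- `H(0, w) = 0`. [cite: Lange2023AbelianVarietiesComplex, §1.2.2 Lemma 1.2.10] -/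
private theorem hermOf_zero_left₉ (η : E [⋀^Fin 2]→L[ℝ] ℝ) (w : E) : hermOf η 0 w = 0 := by
  simpa using hermOf_smul_left η 0 0 w
/-- `H(v, 0) = 0`. [cite: Lange2023AbelianVarietiesComplex, §1.2.2 Lemma 1.2.10] -/
private theorem hermOf_zero_right₉ (η : E [⋀^Fin 2]→L[ℝ] ℝ) (v : E) : hermOf η v 0 = 0 := by
  rw [hermOf_apply, η.map_coord_zero 1 rfl, η.map_coord_zero (m := ![v, 0]) 1 rfl]
  simp
/-- `H_{c•η} = c·H_η` for real `c`. [cite: Lange2023AbelianVarietiesComplex, §1.2.2 Lemma 1.2.10] -/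
private theorem hermOf_real_smul₉ (c : ℝ) (η : E [⋀^Fin 2]→L[ℝ] ℝ) (v w : E) :
    hermOf (c • η) v w = (c : ℂ) * hermOf η v w := by
  simp only [hermOf_apply, ContinuousAlternatingMap.smul_apply, smul_eq_mul]
  push_cast
  ring

variable {ι : Type*} {Φ : (ι → ℝ) ≃L[ℝ] E} {η : E [⋀^Fin 2]→L[ℝ] ℝ}
/-- Integer multiples stay in `NS(X)`. [cite: Lange2023AbelianVarietiesComplex, §1.3.1 (1.10)] -/
private theorem isNSForm_intCast_smul₉ (hη : IsNSForm Φ η) (c : ℤ) : IsNSForm Φ ((c : ℝ) • η) where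
  type_one_one u v := by
    simp only [ContinuousAlternatingMap.smul_apply, hη.type_one_one]
  integral m m' := by
    obtain ⟨a, ha⟩ := hη.integral m m'
    exact ⟨c * a, by rw [ContinuousAlternatingMap.smul_apply, ha, smul_eq_mul, Int.cast_mul]⟩

variable {n : ℕ} (θ : Fin n → (E [⋀^Fin 2]→L[ℝ] ℝ))
/-- `H_{⊞θ}(ι_k x, ι_l y) = δ_{kl} H_k(x, y)` (tree `hermOf_piForm`). [cite: Lange2023AbelianVarietiesComplex, §2.4.4 Thm. 2.4.25] -/
private theorem hermOf_piForm_single₉ (k l : Fin n) (x y : E) :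
    hermOf (piForm θ) (Pi.single k x) (Pi.single l y) = if k = l then hermOf (θ l) x y else 0 := by
  classical
  rw [hermOf_piForm]
  split_ifs with hkl
  · subst hkl
    rw [Finset.sum_eq_single k (fun m _ hm ↦ by rw [Pi.single_eq_of_ne hm, hermOf_zero_left₉])
      (fun h ↦ absurd (Finset.mem_univ _) h), Pi.single_eq_same, Pi.single_eq_same]
  · refine Finset.sum_eq_zero fun m _ ↦ ?_
    by_cases hm : m = k
    · subst hm
      rw [Pi.single_eq_of_ne hkl, hermOf_zero_right₉]
    · rw [Pi.single_eq_of_ne hm, hermOf_zero_left₉]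

end Helpers

/-! ### §1 The diagonal classes `η_c = Σ_k c_k e_k` on `E_τ^g` (`c ∈ ℤ^g`): index `#{k : c_k < 0}` and
`∫_{E^g} η_c^{∧g} = (-1)^g · g! · ∏_k c_k` -/

section Diagonal

variable {g : ℕ} {τ : Fin g → ℂ} (hτ : ∀ k, 0 < (τ k).im) (c : Fin g → ℤ)

/-- `η_c = ⊞_k (c_k · E_τ) ∈ NS(E_τ^g)` — «`b = Σ c_k e_k` (fibre classes)» in the sheet's words.
[cite: Lange2023AbelianVarietiesComplex, §2.4.4 Thm. 2.4.25 and §1.3.1 (1.10)] -/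
theorem isNSForm_diag :
    IsNSForm (piPeriod fun k : Fin g ↦ ellipticPeriod (hτ k).ne')
      (piForm fun k ↦ ((c k : ℤ) : ℝ) • ellipticForm (hτ k).ne') :=
  IsNSForm.pi fun k ↦ isNSForm_intCast_smul₉ (isRiemannForm_ellipticForm (hτ k)).isNSForm (c k)

/-- `H_{E_σ}(1, 1) = 1/Im σ`. [cite: Lange2023AbelianVarietiesComplex, §2.1.1 Example 2.1.3] -/
theorem hermOf_ellipticForm_one_one {σ : ℂ} (hσ : 0 < σ.im) : hermOf (ellipticForm hσ.ne') 1 1 = ((σ.im⁻¹ : ℝ) : ℂ) := by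
  rw [hermOf_self, ellipticForm_apply]
  simp [div_eq_mul_inv]

/-- **`H_{η_c}` is DIAGONAL on the standard complex basis `e_k = (0,…,1,…,0)` of `ℂ^g`, with entries `c_k/Im τ`.**
[cite: Lange2023AbelianVarietiesComplex, §2.4.4 Thm. 2.4.25 and §2.1.1 Example 2.1.3] -/
theorem hermOf_diag (k l : Fin g) :
    hermOf (piForm fun k ↦ ((c k : ℤ) : ℝ) • ellipticForm (hτ k).ne') (Pi.basisFun ℂ (Fin g) k)
        (Pi.basisFun ℂ (Fin g) l) =
      if k = l then (((c k : ℝ) * (τ k).im⁻¹ : ℝ) : ℂ) else 0 := by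
  classical
  rw [Pi.basisFun_apply, Pi.basisFun_apply, hermOf_piForm_single₉]
  split_ifs with h
  · subst h
    rw [hermOf_real_smul₉, hermOf_ellipticForm_one_one (hτ k)]
    push_cast
    ring
  · rfl

/-- **`index(η_c) = #{k : c_k < 0}`** (Sylvester on the diagonal basis; all `c_k ≠ 0`).
[cite: Lange2023AbelianVarietiesComplex, §1.6.2 (p0066)] [cite: GohbergLancasterRodman2005, §2.3 Thm. 2.3.2] -/
theorem hermIndex_diag (hc : ∀ k, c k ≠ 0) :
    hermIndex (piForm fun k ↦ ((c k : ℤ) : ℝ) • ellipticForm (hτ k).ne') =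
      (Finset.univ.filter fun k ↦ c k < 0).card := by
  classical
  rw [hermIndex_eq_card_of_orthogonal _ (isNSForm_diag hτ c).type_one_one (Pi.basisFun ℂ (Fin g))
    (fun k ↦ (c k : ℝ) * (τ k).im⁻¹) (fun k ↦ mul_ne_zero (by exact_mod_cast hc k) (inv_ne_zero (hτ k).ne'))
    (hermOf_diag hτ c)]
  congr 1
  refine Finset.filter_congr fun k _ ↦ ?_
  rw [mul_neg_iff, Int.cast_lt_zero]
  constructor
  · rintro (⟨-, h⟩ | ⟨h, -⟩)
    · exact absurd h (not_lt.2 (inv_pos.2 (hτ k)).le)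
    · exact h
  · exact fun h ↦ Or.inr ⟨h, inv_pos.2 (hτ k)⟩
/-- `η_c` is non-degenerate (all `c_k ≠ 0`). [cite: GohbergLancasterRodman2005, §2.2] -/
theorem nondegenerate_diag (hc : ∀ k, c k ≠ 0) :
    ∀ v : Fin g → ℂ, v ≠ 0 → ∃ u : Fin g → ℂ,
      (piForm fun k ↦ ((c k : ℤ) : ℝ) • ellipticForm (hτ k).ne') ![v, u] ≠ 0 := by
  classical
  exact exists_apply_ne_zero_of_orthogonal _ (isNSForm_diag hτ c).type_one_one (Pi.basisFun ℂ (Fin g))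
    (fun k ↦ (c k : ℝ) * (τ k).im⁻¹) (fun k ↦ mul_ne_zero (by exact_mod_cast hc k) (inv_ne_zero (hτ k).ne'))
    (hermOf_diag hτ c)
/-- The Gram matrix of `η_c` on the lattice basis of `E_τ^g` is `diag(c_k · J₂)`, of determinant `∏_k c_k²`.
[cite: Lange2023AbelianVarietiesComplex, §2.4.4 Thm. 2.4.25 and §2.1.1 Example 2.1.3] -/
theorem det_latticeGram_diag :
    (latticeGram (piPeriod fun k : Fin g ↦ ellipticPeriod (hτ k).ne')
      (piForm fun k ↦ ((c k : ℤ) : ℝ) • ellipticForm (hτ k).ne')).det = ∏ k, ((c k : ℝ)) ^ 2 := by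
  classical
  rw [latticeGram_pi, det_piBlockDiag]
  refine Finset.prod_congr rfl fun k _ ↦ ?_
  rw [latticeGram_smul, latticeGram_elliptic, Matrix.det_smul, Matrix.det_fin_two_of]
  simp
/-- `∏_k c_k = (-1)^{#{k : c_k < 0}} · ∏_k |c_k|` for real `c_k`. [folklore] -/
theorem prod_eq_neg_one_pow_card_mul_prod_abs_aux {κ : Type*} [Fintype κ] (a : κ → ℝ) :
    ∏ k, a k = (-1) ^ (Finset.univ.filter fun k ↦ a k < 0).card * ∏ k, |a k| := by
  classical
  have h : ∀ k, a k = (if a k < 0 then (-1 : ℝ) else 1) * |a k| := fun k ↦ by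
    split_ifs with hk
    · rw [abs_of_neg hk]; ring
    · rw [abs_of_nonneg (not_lt.1 hk)]; ring
  conv_lhs => rw [show (fun k ↦ a k) = fun k ↦ (if a k < 0 then (-1 : ℝ) else 1) * |a k| from funext h]
  rw [Finset.prod_mul_distrib, Finset.prod_ite, Finset.prod_const, Finset.prod_const_one, mul_one]

/-- **`∫_{E_τ^g} η_c^{∧g} = (-1)^{g + #{k : c_k < 0}} · g! · ∏_k |c_k|`** — the tree's self-intersection formula
`(-1)^{g+s} g! d₁⋯d_g` (Lange Lemma 1.7.5 / proof of Thm. 1.7.3) with `s = #{k : c_k < 0}` and `d₁⋯d_g = ∏|c_k|`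
(`(d₁⋯d_g)² = det Gram = ∏ c_k²`). [cite: Lange2023AbelianVarietiesComplex, §1.7.2 Lemma 1.7.5 and proof of Thm. 1.7.3] -/
theorem torusIntegral_wedgePow_diag_eq_abs (hc : ∀ k, c k ≠ 0) (e : Fin (2 * g) ≃ Fin g × Fin 2) :
    torusIntegral (piPeriod fun k : Fin g ↦ ellipticPeriod (hτ k).ne') e
        (wedgePow (ofRealForm (piForm fun k ↦ ((c k : ℤ) : ℝ) • ellipticForm (hτ k).ne')) g) =
      (-1) ^ (g + (Finset.univ.filter fun k ↦ c k < 0).card) * (g.factorial : ℂ) * ∏ k, ((|(c k : ℝ)| : ℝ) : ℂ) := by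
  classical
  have hNS := isNSForm_diag hτ c
  have hnd := nondegenerate_diag hτ c hc
  obtain ⟨g', d, hd, -⟩ := hNS.exists_isPolarizationType_of_nondegenerate _ hnd
  have hg : g' = g := by
    have h' := hd.card_eq
    simp only [Fintype.card_prod, Fintype.card_fin] at h'
    omega
  subst hg
  rw [hNS.torusIntegral_wedgePow_of_isPolarizationType _ hnd hd e, hermIndex_diag hτ c hc]
  have hdet := hd.det_latticeGram
  rw [det_latticeGram_diag hτ c, Finset.prod_pow] at hdet
  have hnn : (0 : ℝ) ≤ ∏ i, (d i : ℝ) := Finset.prod_nonneg fun i _ ↦ Nat.cast_nonneg _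
  have habs : |∏ k, (c k : ℝ)| = ∏ i, (d i : ℝ) := by
    have h := (sq_eq_sq_iff_abs_eq_abs _ _).1 hdet
    rwa [abs_of_nonneg hnn] at h
  rw [Finset.abs_prod] at habs
  have hC : (∏ i, (d i : ℂ)) = ∏ k, ((|(c k : ℝ)| : ℝ) : ℂ) := by
    rw [← Complex.ofReal_prod, habs]
    push_cast
    rfl
  rw [hC]

/-- **`∫_{E_τ^g} (Σ_k c_k e_k)^{∧g} = (-1)^g · g! · ∏_k c_k`** — the closed form (multilinearity: `(Σ c_k e_k)^g =
g!·∏c_k · e₁⋯e_g`, and `∫ e₁⋯e_g = (-1)^g` in the tree's complex orientation, each `∫_{E_τ} E_τ = -1`: Lange's sign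
`(-1)^{g+s}` with `s = 0`). [cite: Lange2023AbelianVarietiesComplex, §1.7.2 Lemma 1.7.5 and proof of Thm. 1.7.3] -/
theorem torusIntegral_wedgePow_diag_eq (hc : ∀ k, c k ≠ 0) (e : Fin (2 * g) ≃ Fin g × Fin 2) :
    torusIntegral (piPeriod fun k : Fin g ↦ ellipticPeriod (hτ k).ne') e
        (wedgePow (ofRealForm (piForm fun k ↦ ((c k : ℤ) : ℝ) • ellipticForm (hτ k).ne')) g) =
      (-1) ^ g * (g.factorial : ℂ) * ∏ k, ((c k : ℝ) : ℂ) := by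
  have hf : (Finset.univ.filter fun k ↦ ((c k : ℝ)) < 0) = Finset.univ.filter fun k ↦ c k < 0 :=
    Finset.filter_congr fun k _ ↦ Int.cast_lt_zero
  rw [torusIntegral_wedgePow_diag_eq_abs hτ c hc e, ← Complex.ofReal_prod, ← Complex.ofReal_prod,
    prod_eq_neg_one_pow_card_mul_prod_abs_aux (fun k ↦ (c k : ℝ)), hf, pow_add]
  push_cast
  ring

end Diagonal

/-! ### §2 Consequences for (S3)'s positivity input: every index is realised on `E_τ^g`; the sign law is sharp at
every `n`; both branches of the object-level signed law (file IV) have inhabited hypothesis sets at every `n = 2m` -/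

section Consequences

variable {g : ℕ} {τ : Fin g → ℂ} (hτ : ∀ k, 0 < (τ k).im)
/-- `#{k < g : k < s} = s` for `s ≤ g`. [folklore] -/
theorem card_filter_val_lt_aux {s : ℕ} (hs : s ≤ g) :
    (Finset.univ.filter fun k : Fin g ↦ (k : ℕ) < s).card = s := by
  rw [← Finset.card_map Fin.valEmbedding]
  have h : (Finset.univ.filter fun k : Fin g ↦ (k : ℕ) < s).map Fin.valEmbedding = Finset.range s := by
    ext m
    simp only [Finset.mem_map, Finset.mem_filter, Finset.mem_univ, true_and, Fin.valEmbedding_apply,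
      Finset.mem_range]
    constructor
    · rintro ⟨k, hk, rfl⟩
      exact hk
    · exact fun hm ↦ ⟨⟨m, lt_of_lt_of_le hm hs⟩, hm, rfl⟩
  rw [h, Finset.card_range]
/-- `E_τ^g` is an abelian variety (`⊞_k E_τ` is a Riemann form). [cite: Lange2023AbelianVarietiesComplex, §2.4.4 Thm. 2.4.25] -/
theorem isAbelianVariety_piElliptic : IsAbelianVariety (piPeriod fun k : Fin g ↦ ellipticPeriod (hτ k).ne') :=
  ⟨piForm fun k ↦ ellipticForm (hτ k).ne', IsRiemannForm.pi fun k ↦ isRiemannForm_ellipticForm (hτ k)⟩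

/-- **EVERY INDEX `0 ≤ s ≤ g` IS REALISED on `E_τ^g`**: the class `η_s = -(e₀ + ⋯ + e_{s-1}) + (e_s + ⋯ + e_{g-1})`
(`c_k = -1` for `k < s`, `+1` otherwise) has `index H_{η_s} = s`.
[cite: Lange2023AbelianVarietiesComplex, §1.6.2 (p0066) and §2.4.4 Thm. 2.4.25] -/
theorem hermIndex_signDiag {s : ℕ} (hs : s ≤ g) :
    hermIndex (piForm fun k : Fin g ↦ (((if (k : ℕ) < s then -1 else 1 : ℤ)) : ℝ) • ellipticForm (hτ k).ne') = s := by
  rw [hermIndex_diag hτ _ (fun k ↦ by split_ifs <;> decide)]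
  have hf : (Finset.univ.filter fun k : Fin g ↦ (if (k : ℕ) < s then -1 else 1 : ℤ) < 0) =
      Finset.univ.filter fun k : Fin g ↦ (k : ℕ) < s :=
    Finset.filter_congr fun k _ ↦ by
      split_ifs with h
      · exact ⟨fun _ ↦ h, fun _ ↦ by decide⟩
      · exact ⟨fun h' ↦ absurd h' (by decide), fun h' ↦ absurd h' h⟩
  rw [hf, card_filter_val_lt_aux hs]
/-- … it is non-degenerate … [cite: GohbergLancasterRodman2005, §2.2] -/
theorem nondegenerate_signDiag (s : ℕ) :
    ∀ v : Fin g → ℂ, v ≠ 0 → ∃ u : Fin g → ℂ,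
      (piForm fun k : Fin g ↦ (((if (k : ℕ) < s then -1 else 1 : ℤ)) : ℝ) • ellipticForm (hτ k).ne') ![v, u] ≠ 0 :=
  nondegenerate_diag hτ _ (fun k ↦ by split_ifs <;> decide)
/-- … and **`∫_{E_τ^g} η_s^{∧g} = (-1)^{g+s} · g!`** (`∏ c_k = (-1)^s`): at EVEN `g` the sign of `∫_X η_s^{∧g}` is `(-1)^s` —
the sign law S3INP-1 realised with BOTH signs at every even dimension.
[cite: Lange2023AbelianVarietiesComplex, §1.7.2 Lemma 1.7.5 and proof of Thm. 1.7.3] -/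
theorem torusIntegral_wedgePow_signDiag_eq {s : ℕ} (hs : s ≤ g) (e : Fin (2 * g) ≃ Fin g × Fin 2) :
    torusIntegral (piPeriod fun k : Fin g ↦ ellipticPeriod (hτ k).ne') e
        (wedgePow (ofRealForm (piForm fun k : Fin g ↦
          (((if (k : ℕ) < s then -1 else 1 : ℤ)) : ℝ) • ellipticForm (hτ k).ne')) g) =
      (-1) ^ (g + s) * (g.factorial : ℂ) := by
  classical
  rw [torusIntegral_wedgePow_diag_eq hτ _ (fun k ↦ by split_ifs <;> decide) e]
  have hprod : ∏ k : Fin g, ((((if (k : ℕ) < s then -1 else 1 : ℤ)) : ℝ) : ℂ) = (-1) ^ s := by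
    have h : ∀ k : Fin g, ((((if (k : ℕ) < s then -1 else 1 : ℤ)) : ℝ) : ℂ) = if (k : ℕ) < s then (-1 : ℂ) else 1 :=
      fun k ↦ by split_ifs <;> simp
    simp_rw [h]
    rw [Finset.prod_ite, Finset.prod_const, Finset.prod_const_one, mul_one, card_filter_val_lt_aux hs]
  rw [hprod, pow_add]
  ring

/-- **S3INP-10 (packaged).** For every `g` and every `0 ≤ s ≤ g` the abelian variety `E_τ^g` carries a class
`η ∈ NS(E_τ^g)`, non-degenerate, of index `s`, with `∫_{E_τ^g} η^{∧g} = (-1)^{g+s} · g!`.  Hence (H1) «`∫_X bⁿ > 0`»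
FAILS for an honest `NS` class at EVERY even `n ≥ 2` (take `s` odd) and holds at every even `n` for `s` even — the lane's
scope clause «(H1) ⟺ index even» is sharp in both directions at every even dimension (so far: `n = 2` file IV, `n = 4` file IVb).
[cite: Lange2023AbelianVarietiesComplex, §1.7.1 Thm. 1.7.1 and §1.7.2 Thm. 1.7.3] -/
theorem exists_isNSForm_hermIndex_eq_torusIntegral_eq {s : ℕ} (hs : s ≤ g) (e : Fin (2 * g) ≃ Fin g × Fin 2) :
    IsAbelianVariety (piPeriod fun k : Fin g ↦ ellipticPeriod (hτ k).ne') ∧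
      ∃ η : (Fin g → ℂ) [⋀^Fin 2]→L[ℝ] ℝ, IsNSForm (piPeriod fun k : Fin g ↦ ellipticPeriod (hτ k).ne') η ∧
        (∀ v : Fin g → ℂ, v ≠ 0 → ∃ u : Fin g → ℂ, η ![v, u] ≠ 0) ∧ hermIndex η = s ∧
        torusIntegral (piPeriod fun k : Fin g ↦ ellipticPeriod (hτ k).ne') e (wedgePow (ofRealForm η) g) =
          (-1) ^ (g + s) * (g.factorial : ℂ) :=
  ⟨isAbelianVariety_piElliptic hτ, _, isNSForm_diag hτ _, nondegenerate_signDiag hτ s, hermIndex_signDiag hτ hs,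
    torusIntegral_wedgePow_signDiag_eq hτ hs e⟩

end Consequences

section EvenDim

variable {m : ℕ} {τ : Fin (2 * m) → ℂ} (hτ : ∀ k, 0 < (τ k).im)

/-- **(H1) FAILS AT EVERY EVEN DIMENSION `n = 2m ≥ 2`**: on `E_τ^{2m}` the class `η₁ = -e₀ + e₁ + ⋯ + e_{2m-1}` (index `1`)
has `∫_X η₁^{∧2m} = -(2m)! < 0`. [cite: Lange2023AbelianVarietiesComplex, §1.7.2 Lemma 1.7.5 and proof of Thm. 1.7.3] -/
theorem torusIntegral_wedgePow_signDiag_one_neg (hm : 0 < m) (e : Fin (2 * (2 * m)) ≃ Fin (2 * m) × Fin 2) :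
    torusIntegral (piPeriod fun k : Fin (2 * m) ↦ ellipticPeriod (hτ k).ne') e
        (wedgePow (ofRealForm (piForm fun k : Fin (2 * m) ↦
          (((if (k : ℕ) < 1 then -1 else 1 : ℤ)) : ℝ) • ellipticForm (hτ k).ne')) (2 * m)) < 0 := by
  rw [torusIntegral_wedgePow_signDiag_eq hτ (by omega) e, pow_add, pow_mul]
  norm_num
  exact_mod_cast Nat.factorial_pos _

/-- **(H1) HOLDS for the principal polarisation `Σ e_k` of `E_τ^{2m}`**: `∫_X (Σ e_k)^{∧2m} = (2m)! > 0` (index `0`).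
[cite: Lange2023AbelianVarietiesComplex, §1.7.2 Thm. 1.7.3] -/
theorem torusIntegral_wedgePow_signDiag_zero_pos (e : Fin (2 * (2 * m)) ≃ Fin (2 * m) × Fin 2) :
    0 < torusIntegral (piPeriod fun k : Fin (2 * m) ↦ ellipticPeriod (hτ k).ne') e
        (wedgePow (ofRealForm (piForm fun k : Fin (2 * m) ↦
          (((if (k : ℕ) < 0 then -1 else 1 : ℤ)) : ℝ) • ellipticForm (hτ k).ne')) (2 * m)) := by
  rw [torusIntegral_wedgePow_signDiag_eq hτ (Nat.zero_le _) e, add_zero, pow_mul]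
  norm_num
  exact_mod_cast Nat.factorial_pos _

/-- **THE χ-IDENTITY BY VALUE IS CONSISTENT WITH EVERY INDEX OF THE RIGHT PARITY, AT EVERY `n = 2m`** (file IV's
hypothesis `hHRR`: `(2w(-4d)ᵐ/(2m)!)·∫_X η^{∧2m} = G·(-2)`): on `E_τ^{2m}`, for EVERY `s ≤ 2m` with `m + s` odd (the
conclusion of file IV's `odd_add_hermIndex_of_chi_identity`, so nothing else can occur) the class `η_s` of index `s`
satisfies the identity with `d = w = 1`, `G = 4ᵐ` (`m = 1, s = 0`: file IV's `G = 4`; `m = 2, s = 1`: file IVb's `G = 16`).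
No sheaf is constructed: this says only that the numerical constraint is equivalent to the parity `m + s` odd at every `n`
— obstruction at `n ≡ 2 (mod 4)` for even index, at `n ≡ 0 (mod 4)` for odd index — and that both hypothesis sets of
file IV's two branches are inhabited at every `n = 2m ≥ 2`.
[cite: Lange2023AbelianVarietiesComplex, §1.7.2 Lemma 1.7.5 and proof of Thm. 1.7.3] -/
theorem chi_identity_signDiag {s : ℕ} (hs : s ≤ 2 * m) (hodd : Odd (m + s))
    (e : Fin (2 * (2 * m)) ≃ Fin (2 * m) × Fin 2) :
    (2 * ((1 : ℝ) : ℂ) * (-4 * ((1 : ℝ) : ℂ)) ^ m / ((2 * m).factorial : ℂ)) *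
        torusIntegral (piPeriod fun k : Fin (2 * m) ↦ ellipticPeriod (hτ k).ne') e
          (wedgePow (ofRealForm (piForm fun k : Fin (2 * m) ↦
            (((if (k : ℕ) < s then -1 else 1 : ℤ)) : ℝ) • ellipticForm (hτ k).ne')) (2 * m)) =
      (((4 : ℝ) ^ m : ℝ) : ℂ) * (-2) := by
  rw [torusIntegral_wedgePow_signDiag_eq hτ hs e]
  have hN : ((2 * m).factorial : ℂ) ≠ 0 := by exact_mod_cast (Nat.factorial_pos _).ne'
  have key : (-4 : ℂ) ^ m * (-1) ^ (2 * m + s) = -(4 : ℂ) ^ m := by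
    rw [neg_pow, show (-1 : ℂ) ^ (2 * m + s) = (-1) ^ s by rw [pow_add, pow_mul]; norm_num,
      show (-1 : ℂ) ^ m * 4 ^ m * (-1) ^ s = (-1) ^ (m + s) * 4 ^ m by rw [pow_add]; ring, hodd.neg_one_pow]
    ring
  push_cast
  calc 2 * (1 : ℂ) * (-4 * 1) ^ m / ((2 * m).factorial : ℂ) * ((-1) ^ (2 * m + s) * ((2 * m).factorial : ℂ))
      = 2 * ((-4 : ℂ) ^ m * (-1) ^ (2 * m + s)) * (((2 * m).factorial : ℂ) / ((2 * m).factorial : ℂ)) := by ring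
    _ = (4 : ℂ) ^ m * (-2) := by rw [key, div_self hN]; ring

/-- … in particular (take `s = m + 1`: `m + s = 2m + 1` odd, `s ≤ 2m` for `m ≥ 1`) file IV's hypothesis set — `η ∈ NS`
non-degenerate, `d, w, G > 0`, the χ-identity — is INHABITED AT EVERY `n = 2m ≥ 2`, by a class of index `m + 1` on `E_τ^{2m}`
(odd index when `m` is even, even index when `m` is odd). [cite: Lange2023AbelianVarietiesComplex, §1.7.2 Lemma 1.7.5 and proof of Thm. 1.7.3] -/
theorem chi_identity_signDiag_succ (hm : 0 < m) (e : Fin (2 * (2 * m)) ≃ Fin (2 * m) × Fin 2) :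
    (2 * ((1 : ℝ) : ℂ) * (-4 * ((1 : ℝ) : ℂ)) ^ m / ((2 * m).factorial : ℂ)) *
        torusIntegral (piPeriod fun k : Fin (2 * m) ↦ ellipticPeriod (hτ k).ne') e
          (wedgePow (ofRealForm (piForm fun k : Fin (2 * m) ↦
            (((if (k : ℕ) < m + 1 then -1 else 1 : ℤ)) : ℝ) • ellipticForm (hτ k).ne')) (2 * m)) =
      (((4 : ℝ) ^ m : ℝ) : ℂ) * (-2) :=
  chi_identity_signDiag hτ (by omega) ⟨m, by ring⟩ e

end EvenDim

end SecantParity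

end Summit.Ventures.HSemireg
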